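import Mathlib
import HarnessLib

/-!
# Clock rigidity for shape-preserving Euler flows, part 1: the clock ODEs
# (crux `EulerZoomLiouville.PowerGaugeEulerLiouville` = stmt-NavierStokesRegularity-19832; line `logtime-breathers` of ns-idea-11, stub T1
# `stub_clockRigidity` — pure-calculus half)

Route `EulerZoomLiouville` (NavierStokesRegularity); width seat ns-ezl-w4 on the interim LEAD ns-typeII-p2 g10's width offer (2026-08-28T06:34:58Z).
A SHAPE-PRESERVING member is `u(τ, y) = θ(τ) V(y/ℓ(τ))` (`τ < 0`) with positive differentiable amplitude and length clocks `θ, ℓ`.  Substituting into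
Euler gives, in the variable `z = y/ℓ`, `α(τ) V + β(τ) (z·∇)V + (V·∇)V = ∇q_τ` with `α = θ'ℓ/θ²`, `β = −ℓ'/θ`.  When `(α, β)` does NOT depend on `τ`
(the non-degenerate branch of stub T1) the clocks solve the autonomous system `θ' = A θ²/ℓ`, `ℓ' = B θ` on `(−∞, 0)`, and this file classifies its
positive solutions — pure one-variable calculus, Mathlib only:

* `ClockRigidity.eq_of_hasDerivAt_zero_Iio` — a function with zero derivative on `(−∞,0)` is constant there (`IsOpen.is_const_of_deriv_eq_zero`);
* `ClockRigidity.clock_trichotomy` — **THE CLASSIFICATION**: either both clocks are EXPONENTIAL with the same nonzero rate (`θ = m e^{cτ}`, `ℓ = L e^{cτ}`,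
  `c ≠ 0`: a log-time breather), or both are POWER LAWS about some `T₀ ≥ 0` (`θ = m (T₀−τ)^{γ−1}`, `ℓ = L (T₀−τ)^γ`: exactly self-similar with some
  exponent; `ℓ > 0` on the whole past forbids a collapse time `T₀ < 0`), or both are CONSTANT (steady).  Proof: `B = 0` ⇒ `ℓ` constant and `(1/θ)' = −A/ℓ₀`
  ⇒ `θ = 1/(k(T₀−τ))` (`γ = 0`) or constant; `B ≠ 0` ⇒ `(θ ℓ^{−k})' = 0` with `k = A/B` ⇒ `ℓ' = BC ℓ^k` ⇒ `k = 1`: `(log ℓ − BCτ)' = 0` (exponential),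
  `k ≠ 1`: `(ℓ^{1−k} − (1−k)BCτ)' = 0` (power law, the sign of the slope and of the intercept being forced by `ℓ^{1−k} > 0` on all of `(−∞,0)`).

The PDE half (derivation of the profile equation from `IsClassicalEulerSolutionOn.momentum`, and the degenerate branch where `(α, β)` moves, killed by
curl-homogeneity + the `E`-gauge) is in the sequel files `…ClockRigidityVorticity`, `…ClockRigidity`.

WHAT THIS IS NOT: not NS, not E, not the crux — calculus `--supports` stmt-19832 (line `logtime-breathers`, stub T1); no summit statement is proved here. [folklore]
-/

noncomputable section

-- flat `Theorems/<Route><Decl>…` files of one crux share the namespace of the crux (tree convention: `Summit.<S>.<S>.…`)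
set_option linter.dupNamespace false

open Set Filter Topology

namespace Summit.NavierStokesRegularity.NavierStokesRegularity.Theorems.PowerGaugeEulerLiouville

namespace ClockRigidity

/-! ### Zero derivative on the past half-line -/

/-- A real function with zero derivative at every `τ < 0` is constant on `(−∞, 0)` (value at `−1`); Mathlib's
`IsOpen.is_const_of_deriv_eq_zero` on the open preconnected set `Iio 0`. [folklore] -/
theorem eq_of_hasDerivAt_zero_Iio {g : ℝ → ℝ} (h : ∀ τ : ℝ, τ < 0 → HasDerivAt g 0 τ) {τ : ℝ} (hτ : τ < 0) :
    g τ = g (-1) :=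
  isOpen_Iio.is_const_of_deriv_eq_zero isPreconnected_Iio
    (fun s hs => (h s hs).differentiableAt.differentiableWithinAt)
    (fun s hs => by simpa using (h s hs).deriv) hτ (by norm_num)

/-! ### The clock trichotomy -/

/-- **CLOCK TRICHOTOMY.**  Let `θ, ℓ : ℝ → ℝ` be positive and differentiable on `(−∞, 0)` and solve there the autonomous clock system of a
shape-preserving Euler flow with frozen profile coefficients, `θ' = A θ²/ℓ`, `ℓ' = B θ` (`A, B ∈ ℝ`).  Then exactly one of the three shapes occurs
on the whole past: EXPONENTIAL clocks with a common nonzero rate (`θ = m e^{cτ}`, `ℓ = L e^{cτ}`, `c ≠ 0`, `m, L > 0`), POWER-LAW clocks about a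
time `T₀ ≥ 0` (`θ = m (T₀ − τ)^{γ−1}`, `ℓ = L (T₀ − τ)^γ`, `m, L > 0`; `γ = 0` is the case `B = 0 ≠ A`), or CONSTANT clocks.  (`B = 0`: `ℓ ≡ ℓ₀`,
`(θ⁻¹ + (A/ℓ₀)τ)' = 0`; `B ≠ 0`, `k = A/B`: `(θ ℓ^{−k})' = 0`, so `ℓ' = BCℓ^k`, and `(log ℓ − BCτ)' = 0` if `k = 1`, `(ℓ^{1−k} − (1−k)BCτ)' = 0` if
`k ≠ 1`; positivity of `θ`, `ℓ` on all of `(−∞,0)` fixes the signs and forces `T₀ ≥ 0`.) [folklore] -/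
theorem clock_trichotomy {θ ℓ : ℝ → ℝ} (hpos : ∀ τ : ℝ, τ < 0 → 0 < θ τ ∧ 0 < ℓ τ)
    (hθd : DifferentiableOn ℝ θ (Iio 0)) (hℓd : DifferentiableOn ℝ ℓ (Iio 0)) {A B : ℝ}
    (hθ' : ∀ τ : ℝ, τ < 0 → deriv θ τ = A * θ τ ^ 2 / ℓ τ)
    (hℓ' : ∀ τ : ℝ, τ < 0 → deriv ℓ τ = B * θ τ) :
    (∃ c m L : ℝ, c ≠ 0 ∧ 0 < m ∧ 0 < L ∧
        ∀ τ : ℝ, τ < 0 → θ τ = m * Real.exp (c * τ) ∧ ℓ τ = L * Real.exp (c * τ)) ∨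
      (∃ T₀ γ m L : ℝ, 0 ≤ T₀ ∧ 0 < m ∧ 0 < L ∧
        ∀ τ : ℝ, τ < 0 → θ τ = m * (T₀ - τ) ^ (γ - 1) ∧ ℓ τ = L * (T₀ - τ) ^ γ) ∨
      (∃ θ₀ ℓ₀ : ℝ, ∀ τ : ℝ, τ < 0 → θ τ = θ₀ ∧ ℓ τ = ℓ₀) := by
  -- derivatives at interior points
  have hθD : ∀ τ : ℝ, τ < 0 → HasDerivAt θ (deriv θ τ) τ := fun τ hτ =>
    (hθd.differentiableAt (Iio_mem_nhds hτ)).hasDerivAt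
  have hℓD : ∀ τ : ℝ, τ < 0 → HasDerivAt ℓ (deriv ℓ τ) τ := fun τ hτ =>
    (hℓd.differentiableAt (Iio_mem_nhds hτ)).hasDerivAt
  by_cases hB : B = 0
  · -- ### `B = 0`: the length clock is frozen
    have hℓ0 : ∀ τ : ℝ, τ < 0 → HasDerivAt ℓ 0 τ := by
      intro τ hτ
      have := hℓD τ hτ
      rwa [hℓ' τ hτ, hB, zero_mul] at this
    set ℓ₀ : ℝ := ℓ (-1) with hℓ₀def
    have hℓc : ∀ τ : ℝ, τ < 0 → ℓ τ = ℓ₀ := fun τ hτ => eq_of_hasDerivAt_zero_Iio hℓ0 hτ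
    have hℓ₀ : 0 < ℓ₀ := (hpos (-1) (by norm_num)).2
    by_cases hA : A = 0
    · -- both clocks constant
      have hθ0 : ∀ τ : ℝ, τ < 0 → HasDerivAt θ 0 τ := by
        intro τ hτ
        have := hθD τ hτ
        rwa [hθ' τ hτ, hA, zero_mul, zero_div] at this
      exact Or.inr (Or.inr ⟨θ (-1), ℓ₀, fun τ hτ => ⟨eq_of_hasDerivAt_zero_Iio hθ0 hτ, hℓc τ hτ⟩⟩)
    · -- `θ' = k θ²`, `k = A/ℓ₀ ≠ 0`: `(θ⁻¹ + kτ)' = 0`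
      set k : ℝ := A / ℓ₀ with hk
      have hk0 : k ≠ 0 := div_ne_zero hA hℓ₀.ne'
      have hg : ∀ τ : ℝ, τ < 0 → HasDerivAt (fun s => (θ s)⁻¹ + k * s) 0 τ := by
        intro τ hτ
        have hθτ : 0 < θ τ := (hpos τ hτ).1
        have h1 : HasDerivAt θ (k * θ τ ^ 2) τ := by
          have := hθD τ hτ
          rw [hθ' τ hτ, hℓc τ hτ] at this
          convert this using 1
          rw [hk]; ring
        refine ((h1.inv hθτ.ne').add ((hasDerivAt_id τ).const_mul k)).congr_deriv ?_
        field_simp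
        ring
      set C : ℝ := (θ (-1))⁻¹ + k * (-1) with hC
      have hinv : ∀ τ : ℝ, τ < 0 → (θ τ)⁻¹ = C - k * τ := by
        intro τ hτ
        have := eq_of_hasDerivAt_zero_Iio hg hτ
        rw [hC]; linarith
      have hP : ∀ τ : ℝ, τ < 0 → 0 < C - k * τ := fun τ hτ => by
        rw [← hinv τ hτ]; exact inv_pos.2 (hpos τ hτ).1
      -- the slope is positive and the intercept nonnegative
      have hkpos : 0 < k := by
        by_contra hkn
        have hkneg : k < 0 := lt_of_le_of_ne (not_lt.1 hkn) hk0
        set τ₁ : ℝ := min (C / k) (-1) with hτ₁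
        have hτ₁0 : τ₁ < 0 := lt_of_le_of_lt (min_le_right _ _) (by norm_num)
        have h1 : τ₁ ≤ C / k := min_le_left _ _
        have h2 : C ≤ k * τ₁ := by
          have := mul_le_mul_of_nonpos_left h1 hkneg.le
          rwa [mul_div_cancel₀ _ hk0] at this
        linarith [hP τ₁ hτ₁0]
      have hCnn : 0 ≤ C := by
        by_contra hCn
        have hCneg : C < 0 := not_le.1 hCn
        have hτ₁0 : C / (2 * k) < 0 := div_neg_of_neg_of_pos hCneg (by positivity)
        have := hP (C / (2 * k)) hτ₁0
        have h3 : k * (C / (2 * k)) = C / 2 := by field_simp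
        linarith
      refine Or.inr (Or.inl ⟨C / k, 0, k⁻¹, ℓ₀, div_nonneg hCnn hkpos.le, inv_pos.2 hkpos, hℓ₀, fun τ hτ => ⟨?_, ?_⟩⟩)
      · have hT : 0 < C / k - τ := by
          have := hP τ hτ
          have h3 : C / k - τ = (C - k * τ) / k := by field_simp
          rw [h3]; positivity
        rw [zero_sub, Real.rpow_neg_one, ← mul_inv, ← inv_inj, inv_inv, hinv τ hτ, mul_sub, mul_div_cancel₀ _ hk0]
      · rw [Real.rpow_zero, mul_one, hℓc τ hτ]
  · -- ### `B ≠ 0`: `k = A/B`, the quantity `θ ℓ^{−k}` is conserved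
    set k : ℝ := A / B with hk
    have hkB : k * B = A := div_mul_cancel₀ A hB
    have hr : ∀ τ : ℝ, τ < 0 → HasDerivAt (fun s => θ s * ℓ s ^ (-k)) 0 τ := by
      intro τ hτ
      have hθτ : 0 < θ τ := (hpos τ hτ).1
      have hℓτ : 0 < ℓ τ := (hpos τ hτ).2
      refine ((hθD τ hτ).mul ((hℓD τ hτ).rpow_const (p := -k) (Or.inl hℓτ.ne'))).congr_deriv ?_
      rw [hθ' τ hτ, hℓ' τ hτ, Real.rpow_sub_one hℓτ.ne', ← hkB]
      field_simp
      ring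
    set C : ℝ := θ (-1) * ℓ (-1) ^ (-k) with hC
    have hCpos : 0 < C := mul_pos (hpos (-1) (by norm_num)).1 (Real.rpow_pos_of_pos (hpos (-1) (by norm_num)).2 _)
    have hcons : ∀ τ : ℝ, τ < 0 → θ τ * ℓ τ ^ (-k) = C := fun τ hτ => eq_of_hasDerivAt_zero_Iio hr hτ
    have hθeq : ∀ τ : ℝ, τ < 0 → θ τ = C * ℓ τ ^ k := by
      intro τ hτ
      have hℓτ : 0 < ℓ τ := (hpos τ hτ).2
      have h1 := hcons τ hτ
      rw [Real.rpow_neg hℓτ.le] at h1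
      have h2 : ℓ τ ^ k ≠ 0 := (Real.rpow_pos_of_pos hℓτ k).ne'
      field_simp at h1
      linarith [h1]
    have hℓD' : ∀ τ : ℝ, τ < 0 → HasDerivAt ℓ (B * C * ℓ τ ^ k) τ := by
      intro τ hτ
      have := hℓD τ hτ
      rwa [hℓ' τ hτ, hθeq τ hτ, ← mul_assoc] at this
    by_cases hk1 : k = 1
    · -- #### `k = 1`: exponential clocks
      set c : ℝ := B * C with hc
      have hc0 : c ≠ 0 := mul_ne_zero hB hCpos.ne'
      have hh : ∀ τ : ℝ, τ < 0 → HasDerivAt (fun s => Real.log (ℓ s) - c * s) 0 τ := by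
        intro τ hτ
        have hℓτ : 0 < ℓ τ := (hpos τ hτ).2
        refine (((hℓD' τ hτ).log hℓτ.ne').sub ((hasDerivAt_id τ).const_mul c)).congr_deriv ?_
        rw [hk1, Real.rpow_one, mul_div_assoc, div_self hℓτ.ne']
        ring
      set D : ℝ := Real.log (ℓ (-1)) - c * (-1) with hD
      have hlog : ∀ τ : ℝ, τ < 0 → Real.log (ℓ τ) = c * τ + D := by
        intro τ hτ
        have := eq_of_hasDerivAt_zero_Iio hh hτ
        rw [hD]; linarith
      have hℓeq : ∀ τ : ℝ, τ < 0 → ℓ τ = Real.exp D * Real.exp (c * τ) := by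
        intro τ hτ
        rw [← Real.exp_add, add_comm, ← hlog τ hτ, Real.exp_log (hpos τ hτ).2]
      refine Or.inl ⟨c, C * Real.exp D, Real.exp D, hc0, mul_pos hCpos (Real.exp_pos D), Real.exp_pos D,
        fun τ hτ => ⟨?_, hℓeq τ hτ⟩⟩
      rw [hθeq τ hτ, hk1, Real.rpow_one, hℓeq τ hτ]
      ring
    · -- #### `k ≠ 1`: power-law clocks
      have h1k : (1 - k) ≠ 0 := sub_ne_zero.2 (Ne.symm hk1)
      set κ' : ℝ := (1 - k) * (B * C) with hκ'
      have hκ'0 : κ' ≠ 0 := mul_ne_zero h1k (mul_ne_zero hB hCpos.ne')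
      have hh : ∀ τ : ℝ, τ < 0 → HasDerivAt (fun s => ℓ s ^ (1 - k) - κ' * s) 0 τ := by
        intro τ hτ
        have hℓτ : 0 < ℓ τ := (hpos τ hτ).2
        refine (((hℓD' τ hτ).rpow_const (p := 1 - k) (Or.inl hℓτ.ne')).sub
          ((hasDerivAt_id τ).const_mul κ')).congr_deriv ?_
        have h2 : ℓ τ ^ k * ℓ τ ^ (1 - k - 1) = 1 := by
          rw [← Real.rpow_add hℓτ, show k + (1 - k - 1) = 0 by ring, Real.rpow_zero]
        rw [hκ']
        linear_combination (B * C * (1 - k)) * h2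
      set D : ℝ := ℓ (-1) ^ (1 - k) - κ' * (-1) with hD
      have hpow : ∀ τ : ℝ, τ < 0 → ℓ τ ^ (1 - k) = κ' * τ + D := by
        intro τ hτ
        have := eq_of_hasDerivAt_zero_Iio hh hτ
        rw [hD]; linarith
      have hP : ∀ τ : ℝ, τ < 0 → 0 < κ' * τ + D := fun τ hτ => by
        rw [← hpow τ hτ]; exact Real.rpow_pos_of_pos (hpos τ hτ).2 _
      -- the slope is negative and the intercept nonnegative
      have hκ'neg : κ' < 0 := by
        by_contra hkn
        have hκ'pos : 0 < κ' := lt_of_le_of_ne (not_lt.1 hkn) (Ne.symm hκ'0)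
        set τ₁ : ℝ := min ((-D - 1) / κ') (-1) with hτ₁
        have hτ₁0 : τ₁ < 0 := lt_of_le_of_lt (min_le_right _ _) (by norm_num)
        have h1 : τ₁ ≤ (-D - 1) / κ' := min_le_left _ _
        have h2 : κ' * τ₁ ≤ -D - 1 := by
          have := mul_le_mul_of_nonneg_left h1 hκ'pos.le
          rwa [mul_div_cancel₀ _ hκ'0] at this
        linarith [hP τ₁ hτ₁0]
      have hDnn : 0 ≤ D := by
        by_contra hDn
        have hDneg : D < 0 := not_le.1 hDn
        have hτ₁0 : -D / (2 * κ') < 0 := div_neg_of_pos_of_neg (by linarith) (by linarith)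
        have := hP (-D / (2 * κ')) hτ₁0
        have h3 : κ' * (-D / (2 * κ')) = -D / 2 := by field_simp
        linarith
      set κ : ℝ := -κ' with hκ
      have hκpos : 0 < κ := by rw [hκ]; linarith
      set T₀ : ℝ := D / κ with hT₀
      have hT₀nn : 0 ≤ T₀ := div_nonneg hDnn hκpos.le
      have hpow' : ∀ τ : ℝ, τ < 0 → ℓ τ ^ (1 - k) = κ * (T₀ - τ) := by
        intro τ hτ
        rw [hpow τ hτ, hT₀, mul_sub, mul_div_cancel₀ _ hκpos.ne', hκ]
        ring
      have hTpos : ∀ τ : ℝ, τ < 0 → 0 ≤ T₀ - τ := fun τ hτ => by linarith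
      set γ : ℝ := (1 - k)⁻¹ with hγ
      have hγk : γ * k = γ - 1 := by
        rw [hγ]; field_simp; ring
      have hℓeq : ∀ τ : ℝ, τ < 0 → ℓ τ = κ ^ γ * (T₀ - τ) ^ γ := by
        intro τ hτ
        rw [← Real.mul_rpow hκpos.le (hTpos τ hτ), ← hpow' τ hτ, hγ,
          Real.rpow_rpow_inv (hpos τ hτ).2.le h1k]
      refine Or.inr (Or.inl ⟨T₀, γ, C * κ ^ (γ - 1), κ ^ γ, hT₀nn,
        mul_pos hCpos (Real.rpow_pos_of_pos hκpos _), Real.rpow_pos_of_pos hκpos _, fun τ hτ => ⟨?_, hℓeq τ hτ⟩⟩)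
      rw [hθeq τ hτ, hℓeq τ hτ, ← Real.mul_rpow hκpos.le (hTpos τ hτ), ← Real.rpow_mul (mul_nonneg hκpos.le (hTpos τ hτ)),
        hγk, Real.mul_rpow hκpos.le (hTpos τ hτ)]
      ring

end ClockRigidity

end Summit.NavierStokesRegularity.NavierStokesRegularity.Theorems.PowerGaugeEulerLiouville

end
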